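import Literature.Algebra.Lie.GradedJacobsonMorozov
import Literature.Algebra.Lie.FilteredLefschetzBigrading
import Literature.Algebra.Lie.LefschetzModuleAdjoint
import HarnessLib

/-!
# Homogeneous `𝔰𝔩₂`-triples inside `𝔤(𝔞, M)` (Looijenga–Lunts 1997, (5.2) applied in `𝔤(𝔞, M)` as in (5.3))

Topic `Literature/Algebra/Lie` (namespace `Literature.Algebra.Lie`).  Lane `lit-hodgefound` (Track 2 foundations
library), skeleton seat `lit-hodgefound-skel-1` (generation 46), row **A1-147** of
`run/shared/lean/pub/lit-hodgefound/SKELETON.md`: row A1-145 (`GradedJacobsonMorozov.lean`, Looijenga–Lunts' Lemma (5.2);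
§5 there: homogeneous `𝔰𝔩₂`-triples in an abstract Lefschetz triple) transported to LEFSCHETZ MODULES `(𝔞, M)` in the
vocabulary of A1-88 (`IsLefschetzModule K h 𝔞`, `lefschetzLieAlgebra K h 𝔞 = 𝔤(𝔞, M) ≤ 𝔤𝔩(M)`, `adDegree K h c`),
along A1-101's `IsLefschetzModule.isLefschetzTriple` (`(𝔤(𝔞, M), h, 𝔞)` is a Lefschetz triple) — the form in which
(5.3) uses (5.2): "we find an `𝔰𝔩₂`-triple `(e_a, h_hor, f_a)` IN `𝔤(𝔞, M)` with `f_a` of total degree `-2` and `h_hor`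
of total degree `0`".  THEOREMS ONLY (no definition, no named fact, no `sorry`, no notation; D-0026 net debt `0`); the
commutator Lie ring of `𝔤𝔩(M) = Module.End K M` is Mathlib's reducible non-instance `LieRing.ofAssociativeRing`,
enabled FILE-LOCALLY exactly as in every `End`-form file of the series (`LefschetzModule.lean`,
`LefschetzModuleAdjoint.lean`, …).

## Source, VERBATIM

E. Looijenga, V. A. Lunts, *A Lie algebra attached to a projective variety*, Invent. Math. **129** (1997) 361–412
(held TeX text `paper:arxiv-alg-geom_9604014`):

> (5.2) p0020 L108–L112: "**Lemma.** Let `𝔤` be a reductive Lie algebra, `𝔰 ⊂ 𝔤` a commutative subalgebra consisting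
> of semisimple elements and `χ ∈ 𝔰^*` a character of `𝔰` in `𝔤`. Then for every nilpotent `e ∈ 𝔤^χ` there exists a
> `f ∈ 𝔤^{-χ}` such that `(e, [e, f], f)` is an `𝔰𝔩(2)`-triple."
> (5.3) p0021 L17–L19: "If we apply 5.2 to `e := e_a` and `𝔰 := ℂh`, we find an `𝔰𝔩₂`-triple `(e_a, h_hor, f_a)` in
> `𝔤(𝔞, M)` with `f_a` of total degree `-2` and `h_hor` of total degree `0`."
> (1.1) p0004 L56–L58: "Notice that `𝔤(𝔞, M)` is evenly graded and that the grading is induced from the action of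
> `ad_h`. We say that `(𝔞, M)` is a Lefschetz module if `𝔤(𝔞, M)` is semisimple."

## Contents (all proved; `K` a field of characteristic `0`, `M` finite-dimensional, `(𝔞, M)` a Lefschetz module)

* **`IsLefschetzModule.exists_mem_lefschetzLieAlgebra_isSl2Triple_of_mem_adDegree`** — for every non-zero
  `x ∈ 𝔤(𝔞, M)` of degree `c ≠ 0` (`[h, x] = c x`) there is `f ∈ 𝔤(𝔞, M)` of degree `-c` with `(x, [x, f], f)` an
  `𝔰𝔩₂`-triple of `𝔤𝔩(M)` and `[x, f] ∈ 𝔤(𝔞, M)` of degree `0` ((5.2) with `𝔤 = 𝔤(𝔞, M)` — semisimple by (1.1) —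
  and `𝔰 = Kh`).
* **`IsLefschetzModule.exists_mem_lefschetzLieAlgebra_isSl2Triple_of_mem`** — in particular EVERY non-zero `a ∈ 𝔞`
  (Lefschetz or not) is the nil-positive element of an `𝔰𝔩₂`-triple `(a, h', f)` INSIDE `𝔤(𝔞, M)` with `h' ∈ 𝔤(𝔞, M)₀`,
  `f ∈ 𝔤(𝔞, M)₋₂` ((5.3)'s `(e_a, h_hor, f_a)`); for a LEFSCHETZ `a` and `h' = h` it is the triple `(a, h, f_a)` of
  (1.1) (`IsLefschetzModule.eq_dual_of_isSl2Triple_of_mem`, uniqueness of the third member).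
* **`IsLefschetzModule.mem_adDegree_neg_of_isSl2Triple`** — conversely the degree of the third member of an
  `𝔰𝔩₂`-triple `(x, h', f)` inside `𝔤(𝔞, M)` with `x` of degree `c` and `h'` of degree `0` is forced: `[h, f] = -c f`
  (A1-145 `mem_adDegree_neg_of_isSl2Triple` in the graded Lie algebra `(𝔤(𝔞, M), ad h)`).

* §2 (rider) **`IsLefschetzModule.exists_horizontal_vertical`** / `…_of_mem` — the Proposition of (5.3) for a
  Lefschetz module and a degree-`2` element `e ∈ 𝔤(𝔞, M)` (e.g. any non-zero `a ∈ 𝔞`): `h = h_hor + h_ver` with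
  `h_hor = [e, f]`, `h_ver ∈ 𝔤(𝔞, M)`, both `ℤ`-diagonalisable and commuting, the bigrading `M = ⊕ M_{k,l}` and
  `M_n = ⊕_k M_{k,n-k}` (row A1-148 `FilteredLefschetzBigrading.lean` inside `𝔤(𝔞, M)`).

* §3 (rider) **`isInternal_comap_subtype_adDegree_inf_adDegree`** / `toSubmodule_eq_iSup_inf_adDegree_inf_adDegree`
  (any Lie subalgebra `𝔤 ≤ 𝔤𝔩(M)` containing commuting `ℤ`-diagonalisable `H, W` is bigraded by `(ad H, ad W)`:
  `𝔤 = ⊕_{(k,l)} 𝔤 ∩ 𝔤𝔩(M)_{k,l}`) and **`IsLefschetzModule.isInternal_lefschetzLieAlgebra_comap_adDegree`** ("the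
  eigen spaces of `(h_hor, h_ver)` under the adjoint representation also define a bigrading of `𝔤(𝔞, M)`"; A1-148
  §5–§6).

## SCOPE

(a) Of (5.3) only the Proposition's conclusion for a given degree-`2` `e ∈ 𝔤(𝔞, M)` (§2) and the adjoint bigrading
of `𝔤(𝔞, M)` (§3) are formalised; the hypotheses on `𝔞_hor` / `Gr_hor M` and the clauses on `𝔞_{2,0}`,
`𝔤(𝔞_{2,0}, M_hor) ≅ 𝔤(𝔞_hor, Gr_hor M)`, `Gr^ver M` ("the image of `𝔞` in `𝔤(𝔞, M)` need not be bigraded") are not.  (b) Nothing here concerns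
complex tori or the Hodge conjecture.

## References

* [LooijengaLunts1997] E. Looijenga, V. A. Lunts, *A Lie algebra attached to a projective variety*, Invent. Math. 129
  (1997) 361–412; arXiv:alg-geom/9604014. §5 (5.2) p. 20 L108–L121, (5.3) p. 21 L17–L19; §1 (1.1) p. 4 L56–L58 of the
  held TeX text.
* [Bourbaki2008LieGroups79] N. Bourbaki, *Lie Groups and Lie Algebras, Chapters 7–9*, Ch. VIII §11 no. 1 Lemma 1,
  no. 2 Lemma 6, Prop. 2 — via the tree's `JacobsonMorozov.lean` and A1-145.
-/

namespace Literature.Algebra.Lie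

open Module Function Set LieAlgebra

-- The commutator Lie ring of `𝔤𝔩(M) = Module.End K M`: Mathlib's reducible NON-instance, enabled file-locally
-- exactly as in `LefschetzModule.lean` / `LefschetzModuleAdjoint.lean`.
attribute [local instance 100] LieRing.ofAssociativeRing

section LefschetzModules

variable {K : Type*} [Field K] [CharZero K] {M : Type*} [AddCommGroup M] [Module K M] [FiniteDimensional K M]
  {h : Module.End K M} {𝔞 : Submodule K (Module.End K M)}

/-- **Homogeneous `𝔰𝔩₂`-triples INSIDE `𝔤(𝔞, M)` ((5.2) for `𝔤 = 𝔤(𝔞, M)`, `𝔰 = Kh`).**  Let `(𝔞, M)` be a Lefschetz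
module and `x ∈ 𝔤(𝔞, M)` a non-zero element of degree `c ≠ 0` (`[h, x] = c • x`).  Then there is `f ∈ 𝔤(𝔞, M)` of
degree `-c` such that `(x, [x, f], f)` is an `𝔰𝔩₂`-triple of `𝔤𝔩(M)`, and its middle element `[x, f]` lies in
`𝔤(𝔞, M)₀` — "we find an `𝔰𝔩₂`-triple `(e_a, h_hor, f_a)` in `𝔤(𝔞, M)` with `f_a` of total degree `-2` and `h_hor` of
total degree `0`".  Proof: `(𝔤(𝔞, M), h, 𝔞)` is a Lefschetz triple (A1-101 `IsLefschetzModule.isLefschetzTriple`), to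
which A1-145 `IsLefschetzTriple.exists_mem_adDegree_isSl2Triple` applies; the triple is pushed into `𝔤𝔩(M)` along the
inclusion (`isSl2Triple_coe_iff`). [cite: LooijengaLunts1997, §5 (5.3) p. 21 L17–L19, (5.2) p. 20 L108–L121] -/
theorem IsLefschetzModule.exists_mem_lefschetzLieAlgebra_isSl2Triple_of_mem_adDegree (A : IsLefschetzModule K h 𝔞)
    {c : K} (hc : c ≠ 0) {x : Module.End K M} (hx : x ∈ lefschetzLieAlgebra K h 𝔞) (hxc : x ∈ adDegree K h c)
    (hx0 : x ≠ 0) :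
    ∃ f ∈ lefschetzLieAlgebra K h 𝔞, f ∈ adDegree K h (-c) ∧ ⁅x, f⁆ ∈ lefschetzLieAlgebra K h 𝔞 ∧
      ⁅x, f⁆ ∈ adDegree K h 0 ∧ IsSl2Triple ⁅x, f⁆ x f := by
  haveI : FiniteDimensional K (lefschetzLieAlgebra K h 𝔞) :=
    inferInstanceAs (FiniteDimensional K (lefschetzLieAlgebra K h 𝔞).toSubmodule)
  set G := lefschetzLieAlgebra K h 𝔞 with hG
  have T := A.isLefschetzTriple
  have hxc' : (⟨x, hx⟩ : G) ∈ adDegree K (⟨h, A.h_mem⟩ : G) c := by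
    rw [mem_adDegree_iff]
    exact Subtype.ext (by rw [LieSubalgebra.coe_bracket]; exact mem_adDegree_iff.1 hxc)
  have hx0' : (⟨x, hx⟩ : G) ≠ 0 := fun h0 ↦ hx0 (congrArg Subtype.val h0)
  obtain ⟨f, hf, hxf, t⟩ := T.exists_mem_adDegree_isSl2Triple hc hxc' hx0'
  refine ⟨(f : Module.End K M), f.2, ?_, (⁅(⟨x, hx⟩ : G), f⁆).2, ?_, ?_⟩
  · have h1 := congrArg Subtype.val (mem_adDegree_iff.1 hf)
    rw [LieSubalgebra.coe_bracket] at h1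
    exact mem_adDegree_iff.2 h1
  · have h1 := congrArg Subtype.val (mem_adDegree_iff.1 hxf)
    rw [LieSubalgebra.coe_bracket, LieSubalgebra.coe_bracket] at h1
    exact mem_adDegree_iff.2 h1
  · have h1 := isSl2Triple_coe_iff.2 t
    rwa [LieSubalgebra.coe_bracket] at h1

/-- **Every non-zero `a ∈ 𝔞` is the nil-positive element of an `𝔰𝔩₂`-triple INSIDE `𝔤(𝔞, M)`** — `(a, h', f)` with
`h' = [a, f] ∈ 𝔤(𝔞, M)₀` and `f ∈ 𝔤(𝔞, M)₋₂` — whether or not `a` is a Lefschetz element ((5.3)'s `(e_a, h_hor, f_a)`: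
the `a` there is Lefschetz only on `Gr_hor M`).  For a LEFSCHETZ `a` the triple with middle element `h` itself is
`(a, h, f_a)` ((1.1), `IsLefschetzModule.eq_dual_of_isSl2Triple_of_mem`). [cite: LooijengaLunts1997, §5 (5.3) p. 21 L17–L19, §1 (1.1) p. 4 L28–L37] -/
theorem IsLefschetzModule.exists_mem_lefschetzLieAlgebra_isSl2Triple_of_mem (A : IsLefschetzModule K h 𝔞)
    {a : Module.End K M} (ha : a ∈ 𝔞) (ha0 : a ≠ 0) :
    ∃ f ∈ lefschetzLieAlgebra K h 𝔞, f ∈ adDegree K h (-2) ∧ ⁅a, f⁆ ∈ lefschetzLieAlgebra K h 𝔞 ∧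
      ⁅a, f⁆ ∈ adDegree K h 0 ∧ IsSl2Triple ⁅a, f⁆ a f :=
  A.exists_mem_lefschetzLieAlgebra_isSl2Triple_of_mem_adDegree two_ne_zero (mem_lefschetzLieAlgebra_of_mem ha)
    (A.le_adDegree_two ha) ha0

/-- For a LEFSCHETZ `a ∈ 𝔞` the homogeneous triple with middle element `h` is the one of (1.1): if `(a, h, f)` is an
`𝔰𝔩₂`-triple then `f = f_a` is the partner (uniqueness of the third member, A1-88
`HasLefschetzProperty.eq_dual_of_isSl2Triple`). [cite: LooijengaLunts1997, §1 (1.1) p. 4 L1–L5 ("This f is then unique")] -/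
theorem IsLefschetzModule.eq_dual_of_isSl2Triple_of_mem (A : IsLefschetzModule K h 𝔞) {a f : Module.End K M}
    (ha : a ∈ lefschetzDomain K h 𝔞) (t : IsSl2Triple h a f) :
    f = (A.hasLefschetzProperty ha).dual A.isZGrading :=
  (A.hasLefschetzProperty ha).eq_dual_of_isSl2Triple A.isZGrading t

/-- **The degree of the third member is forced** inside `𝔤(𝔞, M)`: for an `𝔰𝔩₂`-triple `(x, h', f)` with
`x, h', f ∈ 𝔤(𝔞, M)`, `x` of degree `c` and `h'` of degree `0` (`[h, h'] = 0`), `f` has degree `-c` (Bourbaki VIII §11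
no. 1 Lemma 1 via A1-145 `mem_adDegree_neg_of_isSl2Triple` in the graded semisimple `𝔤(𝔞, M)`).
[cite: LooijengaLunts1997, §5 (5.2) proof, p. 20 L120–L121] [cite: Bourbaki2008LieGroups79, Ch. VIII §11 no. 1 Lemma 1] -/
theorem IsLefschetzModule.mem_adDegree_neg_of_isSl2Triple (A : IsLefschetzModule K h 𝔞) {c : K}
    {x h' f : Module.End K M} (hx : x ∈ lefschetzLieAlgebra K h 𝔞) (hh' : h' ∈ lefschetzLieAlgebra K h 𝔞)
    (hf : f ∈ lefschetzLieAlgebra K h 𝔞) (t : IsSl2Triple h' x f) (hxc : x ∈ adDegree K h c)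
    (hh'0 : h' ∈ adDegree K h 0) : f ∈ adDegree K h (-c) := by
  haveI : FiniteDimensional K (lefschetzLieAlgebra K h 𝔞) :=
    inferInstanceAs (FiniteDimensional K (lefschetzLieAlgebra K h 𝔞).toSubmodule)
  set G := lefschetzLieAlgebra K h 𝔞 with hG
  have T := A.isLefschetzTriple
  have toG : ∀ {y : Module.End K M} (hy : y ∈ G) {d : K}, y ∈ adDegree K h d →
      (⟨y, hy⟩ : G) ∈ adDegree K (⟨h, A.h_mem⟩ : G) d := fun hy d hyd ↦ by
    rw [mem_adDegree_iff]
    exact Subtype.ext (by rw [LieSubalgebra.coe_bracket]; exact mem_adDegree_iff.1 hyd)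
  have t' : IsSl2Triple (⟨h', hh'⟩ : G) ⟨x, hx⟩ ⟨f, hf⟩ := isSl2Triple_coe_iff.1 t
  have h1 := Literature.Algebra.Lie.mem_adDegree_neg_of_isSl2Triple T.iSup_adDegree_eq_top t' (toG hx hxc)
    (toG hh' hh'0)
  have h2 := congrArg Subtype.val (mem_adDegree_iff.1 h1)
  rw [LieSubalgebra.coe_bracket] at h2
  exact mem_adDegree_iff.2 h2

/-! ### §2 (rider) The Proposition of (5.3) for Lefschetz modules: `h = h_hor + h_ver` inside `𝔤(𝔞, M)` -/

/-- **LOOIJENGA–LUNTS (5.3), PROPOSITION (the `𝔤𝔩`-free part), FOR A LEFSCHETZ MODULE `(𝔞, M)` AND A DEGREE-`2` ELEMENT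
`e ∈ 𝔤(𝔞, M)`** ("Then we can write `h = h_hor + h_ver` with `h_hor` and `h_ver` semisimple elements of `𝔤(𝔞, M)` that
have integral eigen values and commute with each other (so for the resulting bigrading of `M`, `M_{k,l}` gets identified
with `Gr^k_hor M_{k+l}`)"): there are `H = h_hor`, `F = f_a` IN `𝔤(𝔞, M)` with `(e, H, F)` an `𝔰𝔩₂`-triple, `H` of
degree `0`, `F` of degree `-2` (§1), `h_ver = h - H ∈ 𝔤(𝔞, M)` (`h ∈ 𝔤(𝔞, M)`, A1-88), `H` and `h - H` `ℤ`-diagonalisable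
and commuting, their joint eigenspaces `M_{k,l} = M_k(H) ⊓ M_l(h - H)` an internal direct sum decomposition of `M` with
`M_n = ⊕_k M_{k,n-k}` (row A1-148 `isInternal_bidegreeSpace`, `degreeSpace_eq_iSup_bidegreeSpace`).  The horizontal
filtration of (5.3) is then `⊕_{j ≥ k} M_j(H)`, the Lefschetz filtration of `e` (A1-148
`isMonodromyWeightFiltration_horFiltration`). [cite: LooijengaLunts1997, §5 (5.3) Proposition, p. 21 L32–L37; L17–L28] -/
theorem IsLefschetzModule.exists_horizontal_vertical (A : IsLefschetzModule K h 𝔞) {e : Module.End K M}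
    (he : e ∈ lefschetzLieAlgebra K h 𝔞) (he2 : e ∈ adDegree K h 2) (he0 : e ≠ 0) :
    ∃ H ∈ lefschetzLieAlgebra K h 𝔞, ∃ F ∈ lefschetzLieAlgebra K h 𝔞,
      IsSl2Triple H e F ∧ H ∈ adDegree K h 0 ∧ F ∈ adDegree K h (-2) ∧ h - H ∈ lefschetzLieAlgebra K h 𝔞 ∧
      IsZGrading H ∧ IsZGrading (h - H) ∧ Commute H (h - H) ∧
      DirectSum.IsInternal (fun p : ℤ × ℤ ↦ degreeSpace H p.1 ⊓ degreeSpace (h - H) p.2) ∧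
      ∀ n : ℤ, degreeSpace h n = ⨆ k : ℤ, degreeSpace H k ⊓ degreeSpace (h - H) (n - k) := by
  obtain ⟨F, hF𝔤, hF2, hH𝔤, hH0, t⟩ :=
    A.exists_mem_lefschetzLieAlgebra_isSl2Triple_of_mem_adDegree two_ne_zero he he2 he0
  have hhH : h * ⁅e, F⁆ = ⁅e, F⁆ * h := by
    have h1 := mem_adDegree_iff.1 hH0
    rw [zero_smul, Ring.lie_def, sub_eq_zero] at h1
    exact h1
  have h1 : ⁅e, F⁆ * e - e * ⁅e, F⁆ = (2 : K) • e := t.lie_h_e_smul K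
  have h2 : ⁅e, F⁆ * F - F * ⁅e, F⁆ = -((2 : K) • F) := t.lie_lie_smul_f K
  have h3 : e * F - F * e = ⁅e, F⁆ := rfl
  have hH : IsZGrading ⁅e, F⁆ := isZGrading_h_of_sl2Triple t.h_ne_zero h1 h2 h3
  refine ⟨⁅e, F⁆, hH𝔤, F, hF𝔤, t, hH0, hF2, ?_, hH, isZGrading_sub_of_commute A.isZGrading hH hhH,
    (sub_mul_comm_of_commute hhH).symm, isInternal_bidegreeSpace A.isZGrading t.h_ne_zero h1 h2 h3 hhH,
    fun n ↦ degreeSpace_eq_iSup_bidegreeSpace hH hhH n⟩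
  exact (lefschetzLieAlgebra K h 𝔞).sub_mem A.h_mem hH𝔤

/-- … in particular for every non-zero `a ∈ 𝔞` (the `e_a` of (5.3)): `h = h_hor + h_ver` with `h_hor = [a, f]`,
`h_ver ∈ 𝔤(𝔞, M)`, both `ℤ`-diagonalisable and commuting, and the bigrading `M = ⊕ M_{k,l}`, `M_n = ⊕_k M_{k,n-k}`.
[cite: LooijengaLunts1997, §5 (5.3) Proposition, p. 21 L32–L37] -/
theorem IsLefschetzModule.exists_horizontal_vertical_of_mem (A : IsLefschetzModule K h 𝔞) {a : Module.End K M}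
    (ha : a ∈ 𝔞) (ha0 : a ≠ 0) :
    ∃ H ∈ lefschetzLieAlgebra K h 𝔞, ∃ F ∈ lefschetzLieAlgebra K h 𝔞,
      IsSl2Triple H a F ∧ H ∈ adDegree K h 0 ∧ F ∈ adDegree K h (-2) ∧ h - H ∈ lefschetzLieAlgebra K h 𝔞 ∧
      IsZGrading H ∧ IsZGrading (h - H) ∧ Commute H (h - H) ∧
      DirectSum.IsInternal (fun p : ℤ × ℤ ↦ degreeSpace H p.1 ⊓ degreeSpace (h - H) p.2) ∧
      ∀ n : ℤ, degreeSpace h n = ⨆ k : ℤ, degreeSpace H k ⊓ degreeSpace (h - H) (n - k) :=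
  A.exists_horizontal_vertical (mem_lefschetzLieAlgebra_of_mem ha) (A.le_adDegree_two ha) ha0

/-! ### §3 (rider) "The eigen spaces of `(h_hor, h_ver)` under the adjoint representation … a bigrading of `𝔤(𝔞, M)`" -/

omit [CharZero K] [FiniteDimensional K M] in
/-- In `𝔤𝔩(M)`, `ad H = (X ↦ HX - XH)` (Mathlib `LieAlgebra.ad_eq_lmul_left_sub_lmul_right`), so `𝔤𝔩(M)_k(ad H)` is the
ring-form degree space of A1-148 §5. [cite: LooijengaLunts1997, §1 (1.1) p. 4 L56–L58] -/
theorem adDegree_intCast_eq_degreeSpace_mulLeft_sub_mulRight (H : Module.End K M) (k : ℤ) :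
    adDegree K H (k : K) = degreeSpace (LinearMap.mulLeft K H - LinearMap.mulRight K H) k := by
  rw [adDegree_intCast_eq_degreeSpace, LieAlgebra.ad_eq_lmul_left_sub_lmul_right]
  rfl

/-- **"The eigen spaces of `(h_hor, h_ver)` under the adjoint representation also define a bigrading of `𝔤(𝔞, M)`"** —
for ANY Lie subalgebra `𝔤 ≤ 𝔤𝔩(M)` and commuting `ℤ`-diagonalisable `H, W ∈ 𝔤`: `𝔤 = ⊕_{(k,l)} 𝔤_{k,l}`,
`𝔤_{k,l} = 𝔤 ∩ 𝔤𝔩(M)_k(ad H) ∩ 𝔤𝔩(M)_l(ad W)` (A1-148 §6: `𝔤` is `ad H`- and `ad W`-stable).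
[cite: LooijengaLunts1997, §5 (5.3) p. 21 L28–L30] -/
theorem isInternal_comap_subtype_adDegree_inf_adDegree (G : LieSubalgebra K (Module.End K M))
    {H W : Module.End K M} (hHG : H ∈ G) (hWG : W ∈ G) (hH : IsZGrading H) (hW : IsZGrading W)
    (hc : H * W = W * H) :
    DirectSum.IsInternal fun p : ℤ × ℤ ↦
      (adDegree K H (p.1 : K) ⊓ adDegree K W (p.2 : K)).comap G.toSubmodule.subtype := by
  simp_rw [adDegree_intCast_eq_degreeSpace_mulLeft_sub_mulRight]
  refine isInternal_comap_subtype_bidegreeSpace_of_forall_mem hH.mulLeft_sub_mulRight hW.mulLeft_sub_mulRight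
    (mulLeft_sub_mulRight_mul_comm hc) (fun X hX ↦ ?_) (fun X hX ↦ ?_)
  · exact G.lie_mem hHG hX
  · exact G.lie_mem hWG hX

/-- … with `𝔤 = ⊕_{(k,l)}` also as subspaces of `𝔤𝔩(M)`: `𝔤 = ⨆_{(k,l)} 𝔤 ∩ 𝔤𝔩(M)_{k,l}`. [cite: LooijengaLunts1997, §5 (5.3) p. 21 L28–L30] -/
theorem toSubmodule_eq_iSup_inf_adDegree_inf_adDegree (G : LieSubalgebra K (Module.End K M))
    {H W : Module.End K M} (hHG : H ∈ G) (hWG : W ∈ G) (hH : IsZGrading H) (hW : IsZGrading W)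
    (hc : H * W = W * H) :
    G.toSubmodule = ⨆ p : ℤ × ℤ, G.toSubmodule ⊓ (adDegree K H (p.1 : K) ⊓ adDegree K W (p.2 : K)) := by
  simp_rw [adDegree_intCast_eq_degreeSpace_mulLeft_sub_mulRight]
  exact eq_iSup_inf_bidegreeSpace_of_forall_mem hH.mulLeft_sub_mulRight hW.mulLeft_sub_mulRight
    (mulLeft_sub_mulRight_mul_comm hc) (fun X hX ↦ G.lie_mem hHG hX) (fun X hX ↦ G.lie_mem hWG hX)

/-- **For a Lefschetz module: `𝔤(𝔞, M) = ⊕_{(k,l)} 𝔤(𝔞, M)_{k,l}`, bigraded by `(ad h_hor, ad h_ver)`** for any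
`ℤ`-diagonalisable `h_hor = H ∈ 𝔤(𝔞, M)` with `h_ver = h - H` `ℤ`-diagonalisable and commuting with `H` — exactly
the data produced by §2 `IsLefschetzModule.exists_horizontal_vertical`. [cite: LooijengaLunts1997, §5 (5.3) p. 21 L28–L30] -/
theorem IsLefschetzModule.isInternal_lefschetzLieAlgebra_comap_adDegree (A : IsLefschetzModule K h 𝔞)
    {H : Module.End K M} (hH𝔤 : H ∈ lefschetzLieAlgebra K h 𝔞) (hH : IsZGrading H) (hV : IsZGrading (h - H))
    (hc : Commute H (h - H)) :
    DirectSum.IsInternal fun p : ℤ × ℤ ↦ (adDegree K H (p.1 : K) ⊓ adDegree K (h - H) (p.2 : K)).comap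
      (lefschetzLieAlgebra K h 𝔞).toSubmodule.subtype :=
  isInternal_comap_subtype_adDegree_inf_adDegree (lefschetzLieAlgebra K h 𝔞) hH𝔤
    ((lefschetzLieAlgebra K h 𝔞).sub_mem A.h_mem hH𝔤) hH hV hc.eq

end LefschetzModules

end Literature.Algebra.Lie
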